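import Literature.NumberTheory.EllipticCurves.FormalGroupMultiplication
import HarnessLib

/-!
# Sharp division by `p` in `E₁(ℚ_p)`: `E⁽²⁾(ℚ_p) = p · E₁(ℚ_p)` for odd `p`
# (team n1011, row T-VIS3-WC FILE 3; seat p09 GEN 10)

HONEST FRAMING (cell `b2b-bsdres`, run/shared/lean/b2b/bsd-rank1-residual/, verbatim in every
file): the goal of the cell is to DELETE the COMBINATION-SHAPED residual classes of the
Birch–Swinnerton-Dyer formula for ALL analytic-rank `≤ 1` elliptic curves over `ℚ` — "full BSD
formula for every rank `≤ 1` curve in class `C`" assembled STRICTLY from published theorems — so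
that the rank-`≤ 1` remainder becomes exactly the CONSTRUCTION-SHAPED classes, which are TYPED
(missing-input `Prop`s), NOT attempted. This is not "finishing BSD". Team n1011 (N10/N11 = X4 ∧
`p = 3`, research route; ROW T-VIS3-WC = the kernel half of r1 ROUTE-1 §41.9 road F3:W).
THIS FILE IS A TOOL: theorems only (no definition, no named fact, no `sorry`); it closes nothing,
books nothing, moves no mark / label / count.

## What and why

FILE 1 (`FormalGroupLocalDivisibility`, generic number field) divides by `p` in the formal group
from depth `|z| ≤ |p|³`, one factor `|p|` short of the truth, because the tree's chart-language
division (`FormalGroupChart.exists_nsmul_eq_of_val_le_mul`) only knows `|z(pQ) - p z(Q)| ≤ |z(Q)|²`.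
Over `ℚ_p` the tree holds much more: the formal multiplication `[p](t)` COMPUTES `z(pQ)`
(`padicEval_formalMul_formalParameter`) and Silverman IV.4.4 `[p](t) = p f(t) + g(tᵖ)` is proved
coefficientwise (`norm_coeff_formalMul_prime_le_of_lt`). Hence:

* §1 **`norm_formalParameter_prime_nsmul_sub_le_max`** — the SHARP estimate
  `‖z(pQ) - p·z(Q)‖ ≤ max(‖p‖·‖z(Q)‖², ‖z(Q)‖ᵖ)` on `E₁(ℚ_p)`;
* §2 **`exists_nsmul_eq_of_norm_formalParameter_le_inv_sq`** — for ODD `p`, every `T ∈ E₁(ℚ_p)`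
  with `‖z(T)‖ ≤ p⁻²` is `p • Q` with `Q ∈ E₁(ℚ_p)` (successive approximation with ratio `p⁻¹`,
  the inverse dictionary `exists_isInReductionKernel_formalParameter_eq` as the lift, completeness
  of `ℚ_p`) — i.e. `E⁽²⁾(ℚ_p) ⊆ p E₁(ℚ_p)`; this is Silverman IV.6.4(b) at `r = 1 > v(p)/(p-1)`,
  the level the tree's limit logarithm (`PadicPointsFiltrationProofs`, levels `≥ 2`) does not reach;
* §2b **`map_nsmul_formalFiltration_one_eq_two`** — the subgroup identity
  `p · E⁽¹⁾(ℚ_p) = E⁽²⁾(ℚ_p)` (`WeierstrassCurve.formalFiltration`) for odd `p`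
  (`⊆`: `norm_formalParameter_prime_nsmul_le_inv_sq`, every `p`);
* §3 the rational-point reading: `exists_nsmul_eq_of_one_lt_norm_of_norm_le` — `P = (x, y)` with
  `‖x‖ > 1` and `‖x / y‖ ≤ p⁻²` is `p • Q` in `E(ℚ_p)` (odd `p`).

Why it matters (EVIDENCE, r1's population; seat n1011-p09 GEN 10 pilot `rep_census.py`): on the
480 witness pairs of `route1/g29_w3_n11.tsv` a representative `T = m(aP₁+bP₂) + 3R` (`|c|, |d| ≤ 4`)
of depth `v₃(z) ≥ 2` exists for 475/480 (x-coordinates of 4–72 digits, median 9), of depth `≥ 3`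
for 339/480 only — and e.g. for `18774l1` depth `3` is provably unreachable
(`E'(ℚ) ∩ E₁(ℚ₃) ⊆ E⁽²⁾`). The companion FILE 2 (`FormalGroupLocalDivisibilityRat`) transports §3
to the `v.adicCompletion ℚ` currency of `hdiv`.

## References (provenance; nothing cited as a fact)

* [SilvermanAEC2009] J. H. Silverman, *The Arithmetic of Elliptic Curves*, 2nd ed.: IV.2.3, IV.4.4
  (`[p] = pf + g(Tᵖ)`), Thm. IV.6.4(b), Prop. VII.2.2.

## Design

`noncomputable section`; theorems only; the successive approximation is adapted from the tree's
`FormalGroupChart.exists_nsmul_eq_of_val_le_mul` / `WeierstrassCurve.exists_mem_padicLimitLog_eq`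
with the sharp estimate in place of the quadratic one. Axioms: `propext`, `Classical.choice`,
`Quot.sound`.
-/

noncomputable section

open scoped Classical Topology
open Filter PowerSeries Literature.NumberTheory.EllipticCurves

namespace Summit.BirchSwinnertonDyer.Rank1Residual.GaloisImage.LocalDivisibility

variable {p : ℕ} [Fact p.Prime] (W : WeierstrassCurve ℚ_[p]) [hW : W.IsIntegral ℤ_[p]]
  [W.IsElliptic]

/-! ### §1. The sharp estimate `‖z(pQ) - p z(Q)‖ ≤ max(‖p‖‖z(Q)‖², ‖z(Q)‖ᵖ)` -/

omit [W.IsElliptic] in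
/-- **`‖z(pQ) - p·z(Q)‖ ≤ max(‖p‖·‖z(Q)‖², ‖z(Q)‖ᵖ)` on `E₁(ℚ_p)`** (`p`-integral `W`):
`z(pQ) = [p](z(Q))` (`padicEval_formalMul_formalParameter`), `[p](t) = Σ cₖ tᵏ` with `c₀ = 0`,
`c₁ = p` (`coeff_one_formalMul`), `‖cₖ‖ ≤ ‖p‖` for `k < p` (Silverman IV.4.4,
`norm_coeff_formalMul_prime_le_of_lt`) and `‖cₖ‖ ≤ 1` always; the ultrametric inequality for the
series without its linear term. [cite: SilvermanAEC2009, IV.4.4] -/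
theorem norm_formalParameter_prime_nsmul_sub_le_max {Q : W.toAffine.Point}
    (hQ : W.IsInReductionKernel Q) :
    ‖W.formalParameter (p • Q) - p * W.formalParameter Q‖ ≤
      max (‖(p : ℚ_[p])‖ * ‖W.formalParameter Q‖ ^ 2) (‖W.formalParameter Q‖ ^ p) := by
  have hp : p.Prime := Fact.out
  set t := W.formalParameter Q with ht_def
  have ht : ‖t‖ < 1 := W.norm_formalParameter_lt_one hQ
  have ht1 : ‖t‖ ≤ 1 := ht.le
  rw [← W.padicEval_formalMul_formalParameter p hQ]
  have hsum := hasSum_padicEval (W.isPadicInt_formalMul p) ht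
  have hsub := hasSum_ite_sub_hasSum hsum 1
  rw [W.coeff_one_formalMul p, pow_one] at hsub
  rw [← hsub.tsum_eq]
  set M : ℝ := max (‖(p : ℚ_[p])‖ * ‖t‖ ^ 2) (‖t‖ ^ p) with hM
  have hM0 : 0 ≤ M := le_max_of_le_right (pow_nonneg (norm_nonneg t) p)
  refine IsUltrametricDist.norm_tsum_le_of_forall_le_of_nonneg hM0 fun n ↦ ?_
  by_cases hn1 : n = 1
  · rw [if_pos hn1, norm_zero]; exact hM0
  rw [if_neg hn1]
  rcases Nat.lt_or_ge n 2 with hn2 | hn2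
  · -- `n = 0`: the constant term vanishes
    obtain rfl : n = 0 := by omega
    rw [coeff_zero_eq_constantCoeff_apply, W.constantCoeff_formalMul, zero_mul, norm_zero]
    exact hM0
  rw [norm_mul, norm_pow]
  rcases Nat.lt_or_ge n p with hnp | hnp
  · -- `2 ≤ n < p`: `‖cₙ‖ ≤ ‖p‖`, `‖t‖ⁿ ≤ ‖t‖²`
    calc ‖coeff n (W.formalMul p)‖ * ‖t‖ ^ n ≤ ‖(p : ℚ_[p])‖ * ‖t‖ ^ 2 :=
          mul_le_mul (W.norm_coeff_formalMul_prime_le_of_lt hnp)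
            (pow_le_pow_of_le_one (norm_nonneg t) ht1 hn2) (pow_nonneg (norm_nonneg t) n)
            (norm_nonneg _)
      _ ≤ M := le_max_left _ _
  · -- `p ≤ n`: `‖cₙ‖ ≤ 1`, `‖t‖ⁿ ≤ ‖t‖ᵖ`
    calc ‖coeff n (W.formalMul p)‖ * ‖t‖ ^ n ≤ 1 * ‖t‖ ^ p :=
          mul_le_mul (isPadicInt_iff_coeff.mp (W.isPadicInt_formalMul p) n)
            (pow_le_pow_of_le_one (norm_nonneg t) ht1 hnp) (pow_nonneg (norm_nonneg t) n)
            zero_le_one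
      _ = ‖t‖ ^ p := one_mul _
      _ ≤ M := le_max_right _ _

omit [W.IsElliptic] in
/-- **The contraction for odd `p`**: for `p ≠ 2` and `‖z(Q)‖ ≤ p⁻¹`, `‖z(pQ) - p z(Q)‖ ≤ p⁻² · ‖z(Q)‖`
(`‖p‖‖z‖² = p⁻¹‖z‖·‖z‖ ≤ p⁻²‖z‖` and `‖z‖ᵖ = ‖z‖ᵖ⁻¹·‖z‖ ≤ p⁻⁽ᵖ⁻¹⁾‖z‖ ≤ p⁻²‖z‖` as `p - 1 ≥ 2`).
[cite: SilvermanAEC2009, IV.4.4] -/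
theorem norm_formalParameter_prime_nsmul_sub_le_of_odd (hp2 : p ≠ 2) {Q : W.toAffine.Point}
    (hQ : W.IsInReductionKernel Q) (hQ1 : ‖W.formalParameter Q‖ ≤ (p : ℝ)⁻¹) :
    ‖W.formalParameter (p • Q) - p * W.formalParameter Q‖ ≤
      ((p : ℝ)⁻¹) ^ 2 * ‖W.formalParameter Q‖ := by
  have hp : p.Prime := Fact.out
  have hp3 : 3 ≤ p := by
    rcases hp.eq_two_or_odd' with h | h
    · exact absurd h hp2
    · have := hp.two_le; omega
  have hpR : (0 : ℝ) < p := by exact_mod_cast hp.pos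
  set θ : ℝ := (p : ℝ)⁻¹ with hθ
  have hθ0 : 0 ≤ θ := inv_nonneg.mpr hpR.le
  have hθ1 : θ ≤ 1 := inv_le_one_of_one_le₀ (by exact_mod_cast hp.one_lt.le)
  set r := ‖W.formalParameter Q‖ with hr
  have hr0 : 0 ≤ r := norm_nonneg _
  have hrr : r * r ≤ θ * r := mul_le_mul_of_nonneg_right hQ1 hr0
  refine (norm_formalParameter_prime_nsmul_sub_le_max W hQ).trans (max_le ?_ ?_)
  · rw [Padic.norm_p]
    calc (p : ℝ)⁻¹ * r ^ 2 = θ * (r * r) := by rw [hθ]; ring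
      _ ≤ θ * (θ * r) := mul_le_mul_of_nonneg_left hrr hθ0
      _ = θ ^ 2 * r := by ring
  · obtain ⟨k, hk⟩ : ∃ k, p = k + 3 := ⟨p - 3, by omega⟩
    have hrk : r ^ p = r ^ (k + 1) * (r * r) := by rw [hk]; ring
    have h1 : r ^ (k + 1) ≤ θ :=
      (pow_le_pow_left₀ hr0 hQ1 (k + 1)).trans (pow_le_of_le_one hθ0 hθ1 (Nat.succ_ne_zero k))
    rw [hrk]
    calc r ^ (k + 1) * (r * r) ≤ θ * (θ * r) := mul_le_mul h1 hrr (mul_nonneg hr0 hr0) hθ0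
      _ = θ ^ 2 * r := by ring

/-! ### §2. `E⁽²⁾(ℚ_p) ⊆ p · E₁(ℚ_p)` for odd `p` -/

/-- Completeness of `ℚ_p` with a geometric rate: a sequence with `‖x_{k+1} - x_k‖ ≤ C θᵏ`,
`θ < 1`, has a limit `y` with `‖y - x_k‖ ≤ C θᵏ` for every `k` (ultrametric telescoping + Mathlib
`cauchySeq_of_le_geometric`). The `ℚ_p` twin of the tree's `LocalPoints.exists_limit_of_geometric`.
[folklore] -/
theorem padic_exists_limit_of_geometric (x : ℕ → ℚ_[p]) (C θ : ℝ) (hC : 0 ≤ C) (hθ0 : 0 ≤ θ)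
    (hθ : θ < 1) (hx : ∀ k, ‖x (k + 1) - x k‖ ≤ C * θ ^ k) :
    ∃ y : ℚ_[p], ∀ k, ‖y - x k‖ ≤ C * θ ^ k := by
  have htail : ∀ k m, ‖x (k + m) - x k‖ ≤ C * θ ^ k := by
    intro k m
    induction m with
    | zero => rw [add_zero, sub_self, norm_zero]; positivity
    | succ m ih =>
      have e : x (k + (m + 1)) - x k = (x (k + m + 1) - x (k + m)) + (x (k + m) - x k) := by
        rw [← add_assoc]; ring
      rw [e]
      refine (IsUltrametricDist.norm_add_le_max _ _).trans (max_le ?_ ih)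
      calc ‖x (k + m + 1) - x (k + m)‖ ≤ C * θ ^ (k + m) := hx (k + m)
        _ ≤ C * θ ^ k := by
            rw [pow_add]
            exact mul_le_mul_of_nonneg_left (mul_le_of_le_one_right (pow_nonneg hθ0 k)
              (pow_le_one₀ hθ0 hθ.le)) hC
  have hCauchy : CauchySeq x :=
    cauchySeq_of_le_geometric θ C hθ fun k ↦ by rw [dist_comm, dist_eq_norm]; exact hx k
  obtain ⟨y, hy⟩ := cauchySeq_tendsto_of_complete hCauchy
  refine ⟨y, fun k ↦ ?_⟩
  have hlim : Tendsto (fun m ↦ ‖x (m + k) - x k‖) atTop (𝓝 ‖y - x k‖) :=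
    ((hy.comp (tendsto_add_atTop_nat k)).sub_const (x k)).norm
  exact le_of_tendsto' hlim fun m ↦ by rw [add_comm]; exact htail k m

/-- **Sharp division by an odd prime `p` in `E₁(ℚ_p)`: `E⁽²⁾(ℚ_p) ⊆ p E₁(ℚ_p)`.** For a
`p`-integral elliptic `W/ℚ_p`, `p ≠ 2`, every `T ∈ E₁(ℚ_p)` with `‖z(T)‖ ≤ p⁻²` is `p • Q` for some
`Q ∈ E₁(ℚ_p)` with `‖z(Q)‖ ≤ p⁻¹`. Proof: successive approximation — from a residual `T'` with
`‖z(T')‖ ≤ p⁻²·p⁻ᵏ` pass to `T' - p•Q`, `Q = z⁻¹(z(T')/p)` (inverse dictionary,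
`exists_isInReductionKernel_formalParameter_eq`), of parameter
`‖z(T') - z(pQ)‖ = ‖p z(Q) - z(pQ)‖ ≤ p⁻²‖z(Q)‖ ≤ p⁻²·p⁻⁽ᵏ⁺¹⁾` (§1, this is where `p` odd enters);
the partial sums of the `Q`'s have Cauchy parameters, their limit is a parameter `z(P)`, and
`T - p • P` has parameter `≤ p⁻¹⁻ᵏ` for every `k`, hence is `O`. This is Silverman IV.6.4(b) at the
level `r = 1 > v(p)/(p - 1)` (false for `p = 2`). [cite: SilvermanAEC2009, Thm. IV.6.4]
[cite: SilvermanAEC2009, Prop. VII.2.2] -/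
theorem exists_nsmul_eq_of_norm_formalParameter_le_inv_sq (hp2 : p ≠ 2) {T : W.toAffine.Point}
    (hT : W.IsInReductionKernel T) (hTz : ‖W.formalParameter T‖ ≤ ((p : ℝ)⁻¹) ^ 2) :
    ∃ Q : W.toAffine.Point, W.IsInReductionKernel Q ∧ ‖W.formalParameter Q‖ ≤ (p : ℝ)⁻¹ ∧
      p • Q = T := by
  have hp : p.Prime := Fact.out
  have hpR : (0 : ℝ) < p := by exact_mod_cast hp.pos
  have hp0 : (p : ℚ_[p]) ≠ 0 := Nat.cast_ne_zero.mpr hp.ne_zero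
  set θ : ℝ := (p : ℝ)⁻¹ with hθ
  have hθ0 : 0 ≤ θ := inv_nonneg.mpr hpR.le
  have hθ1 : θ < 1 := inv_lt_one_of_one_lt₀ (by exact_mod_cast hp.one_lt)
  have hθle : ∀ k : ℕ, θ ^ k ≤ 1 := fun k ↦ pow_le_one₀ hθ0 hθ1.le
  have hnp : ‖(p : ℚ_[p])‖ = θ := Padic.norm_p
  -- the lift: a point with prescribed parameter
  have hex : ∀ s : ℚ_[p], ∃ P : W.toAffine.Point,
      ‖s‖ < 1 → W.IsInReductionKernel P ∧ W.formalParameter P = s := by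
    intro s
    by_cases hs : ‖s‖ < 1
    · obtain ⟨P, hP, hPs⟩ := W.exists_isInReductionKernel_formalParameter_eq hs
      exact ⟨P, fun _ ↦ ⟨hP, hPs⟩⟩
    · exact ⟨0, fun h ↦ absurd h hs⟩
  choose pt hpt using hex
  -- the invariant of the recursion at level `k`: residual `s.1`, partial sum `s.2`
  let Inv : ℕ → W.toAffine.Point × W.toAffine.Point → Prop := fun k s ↦
    W.IsInReductionKernel s.1 ∧ W.IsInReductionKernel s.2 ∧
      ‖W.formalParameter s.1‖ ≤ θ ^ 2 * θ ^ k ∧ ‖W.formalParameter s.2‖ ≤ θ ∧ T = s.1 + p • s.2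
  have hInv0 : Inv 0 (T, 0) := by
    refine ⟨hT, W.isInReductionKernel_zero, by rwa [pow_zero, mul_one], ?_, ?_⟩
    · change ‖W.formalParameter 0‖ ≤ θ
      rw [W.formalParameter_zero, norm_zero]; exact hθ0
    · change T = T + p • (0 : W.toAffine.Point)
      rw [nsmul_zero, add_zero]
  -- the step
  have hstep : ∀ (k : ℕ) (s : {s // Inv k s}), ∃ s' : {s' // Inv (k + 1) s'},
      ‖W.formalParameter s'.1.2 - W.formalParameter s.1.2‖ ≤ θ * θ ^ k := by
    rintro k ⟨⟨T', S⟩, hT'K, hSK, hT'z, hSz, hTS⟩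
    dsimp only at hT'K hSK hT'z hSz hTS
    set b : ℚ_[p] := W.formalParameter T' / (p : ℚ_[p]) with hb
    have hbθ : ‖b‖ ≤ θ * θ ^ k := by
      rw [hb, norm_div, hnp, div_le_iff₀ (hθ0.lt_of_ne' (by positivity)), hθ]
      calc ‖W.formalParameter T'‖ ≤ θ ^ 2 * θ ^ k := hT'z
        _ = (p : ℝ)⁻¹ * (p : ℝ)⁻¹ ^ k * (p : ℝ)⁻¹ := by rw [hθ]; ring
    have hbθ' : ‖b‖ ≤ θ := hbθ.trans (mul_le_of_le_one_right hθ0 (hθle k))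
    have hb1 : ‖b‖ < 1 := hbθ'.trans_lt hθ1
    obtain ⟨hQK, hQz⟩ := hpt b hb1
    set Q := pt b with hQdef
    have hQθ : ‖W.formalParameter Q‖ ≤ θ := by rw [hQz]; exact hbθ'
    have hpQK : W.IsInReductionKernel (p • Q) := W.isInReductionKernel_nsmul hQK p
    have hnegpQK : W.IsInReductionKernel (-(p • Q)) := W.isInReductionKernel_neg hpQK
    refine ⟨⟨(T' - p • Q, S + Q), ?_, W.isInReductionKernel_add hSK hQK, ?_, ?_, ?_⟩, ?_⟩
    · rw [sub_eq_add_neg]; exact W.isInReductionKernel_add hT'K hnegpQK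
    · -- the new residual
      change ‖W.formalParameter (T' - p • Q)‖ ≤ θ ^ 2 * θ ^ (k + 1)
      refine (W.norm_formalParameter_sub_le hT'K hpQK).trans ?_
      have e : W.formalParameter T' - W.formalParameter (p • Q) =
          -(W.formalParameter (p • Q) - p * W.formalParameter Q) := by
        rw [hQz, hb, mul_div_cancel₀ _ hp0]; ring
      rw [e, norm_neg]
      calc ‖W.formalParameter (p • Q) - p * W.formalParameter Q‖ ≤ θ ^ 2 * ‖W.formalParameter Q‖ :=
            norm_formalParameter_prime_nsmul_sub_le_of_odd W hp2 hQK hQθ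
        _ ≤ θ ^ 2 * (θ * θ ^ k) := by rw [hQz]; exact mul_le_mul_of_nonneg_left hbθ (sq_nonneg θ)
        _ = θ ^ 2 * θ ^ (k + 1) := by ring
    · change ‖W.formalParameter (S + Q)‖ ≤ θ
      exact (W.norm_formalParameter_add_le hSK hQK).trans (max_le hSz hQθ)
    · change T = (T' - p • Q) + p • (S + Q)
      rw [hTS, nsmul_add]
      abel
    · change ‖W.formalParameter (S + Q) - W.formalParameter S‖ ≤ θ * θ ^ k
      exact (W.norm_formalParameter_add_sub_le hQK hSK).trans (by rw [hQz]; exact hbθ)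
  choose next hnext using hstep
  -- the sequence of approximations and the Cauchy property of the partial sums' parameters
  let seq : ∀ k : ℕ, {s // Inv k s} := fun k ↦ Nat.rec ⟨(T, 0), hInv0⟩ (fun k s ↦ next k s) k
  have hseq_succ : ∀ k, seq (k + 1) = next k (seq k) := fun k ↦ rfl
  have hseq_zero : (seq 0).1.2 = 0 := rfl
  have hcauchy : ∀ k, ‖W.formalParameter (seq (k + 1)).1.2 - W.formalParameter (seq k).1.2‖ ≤
      θ * θ ^ k := by
    intro k
    rw [hseq_succ]
    exact hnext k (seq k)
  obtain ⟨y, hy⟩ := padic_exists_limit_of_geometric (fun k ↦ W.formalParameter (seq k).1.2) θ θ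
    hθ0 hθ0 hθ1 hcauchy
  have hy0 : ‖y‖ ≤ θ := by
    have h := hy 0
    rw [hseq_zero, W.formalParameter_zero, sub_zero, pow_zero, mul_one] at h
    exact h
  obtain ⟨hPK, hPz⟩ := hpt y (hy0.trans_lt hθ1)
  set P := pt y with hPdef
  refine ⟨P, hPK, by rw [hPz]; exact hy0, ?_⟩
  -- `D = T - p • P` has arbitrarily small parameter
  have hpPK : W.IsInReductionKernel (p • P) := W.isInReductionKernel_nsmul hPK p
  have hDK : W.IsInReductionKernel (T - p • P) := by
    rw [sub_eq_add_neg]; exact W.isInReductionKernel_add hT (W.isInReductionKernel_neg hpPK)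
  have hDsmall : ∀ k, ‖W.formalParameter (T - p • P)‖ ≤ θ * θ ^ k := by
    intro k
    obtain ⟨hT'K, hSK, hT'z, -, hTS⟩ := (seq k).2
    have hSPK : W.IsInReductionKernel ((seq k).1.2 - P) := by
      rw [sub_eq_add_neg]; exact W.isInReductionKernel_add hSK (W.isInReductionKernel_neg hPK)
    have hNSPK : W.IsInReductionKernel (p • ((seq k).1.2 - P)) := W.isInReductionKernel_nsmul hSPK p
    have eD : T - p • P = (seq k).1.1 + p • ((seq k).1.2 - P) := by
      conv_lhs => rw [hTS]
      rw [nsmul_sub]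
      abel
    rw [eD]
    refine (W.norm_formalParameter_add_le hT'K hNSPK).trans (max_le ?_ ?_)
    · calc ‖W.formalParameter (seq k).1.1‖ ≤ θ ^ 2 * θ ^ k := hT'z
        _ = θ * (θ * θ ^ k) := by ring
        _ ≤ 1 * (θ * θ ^ k) := by gcongr
        _ = θ * θ ^ k := one_mul _
    · calc ‖W.formalParameter (p • ((seq k).1.2 - P))‖ ≤ ‖W.formalParameter ((seq k).1.2 - P)‖ :=
            W.norm_formalParameter_nsmul_le hSPK p
        _ ≤ ‖W.formalParameter (seq k).1.2 - W.formalParameter P‖ :=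
            W.norm_formalParameter_sub_le hSK hPK
        _ = ‖y - W.formalParameter (seq k).1.2‖ := by rw [hPz, ← norm_neg, neg_sub]
        _ ≤ θ * θ ^ k := hy k
  have hD0 : W.formalParameter (T - p • P) = 0 := by
    refine padic_eq_zero_of_norm_le_p_pow fun n hn ↦ ?_
    obtain ⟨k, rfl⟩ : ∃ k, n = k + 1 := ⟨n - 1, by omega⟩
    calc ‖W.formalParameter (T - p • P)‖ ≤ θ * θ ^ k := hDsmall k
      _ = ((p : ℝ)⁻¹) ^ (k + 1) := by rw [hθ]; ring
  have hD : T - p • P = 0 := (W.formalParameter_eq_zero_iff hDK).mp hD0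
  exact (sub_eq_zero.mp hD).symm


/-! ### §2b. In the filtration language: `p · E⁽¹⁾(ℚ_p) = E⁽²⁾(ℚ_p)` for odd `p` -/

omit [W.IsElliptic] in
/-- **`p · E⁽¹⁾(ℚ_p) ⊆ E⁽²⁾(ℚ_p)` (every prime `p`)**: for `Q ∈ E₁(ℚ_p)` with `‖z(Q)‖ ≤ p⁻¹`,
`‖z(pQ)‖ ≤ p⁻²` — `‖z(pQ)‖ ≤ max(‖p z(Q)‖, ‖z(pQ) - p z(Q)‖)` and §1. [cite: SilvermanAEC2009, IV.4.4] -/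
theorem norm_formalParameter_prime_nsmul_le_inv_sq {Q : W.toAffine.Point} (hQ : W.IsInReductionKernel Q)
    (hQ1 : ‖W.formalParameter Q‖ ≤ (p : ℝ)⁻¹) :
    ‖W.formalParameter (p • Q)‖ ≤ ((p : ℝ)⁻¹) ^ 2 := by
  have hp : p.Prime := Fact.out
  have hpR : (0 : ℝ) < p := by exact_mod_cast hp.pos
  have hθ0 : 0 ≤ (p : ℝ)⁻¹ := inv_nonneg.mpr hpR.le
  have hθ1 : (p : ℝ)⁻¹ ≤ 1 := inv_le_one_of_one_le₀ (by exact_mod_cast hp.one_lt.le)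
  set r := ‖W.formalParameter Q‖ with hr
  have hr0 : 0 ≤ r := norm_nonneg _
  have hr1 : r ≤ 1 := hQ1.trans hθ1
  have e : W.formalParameter (p • Q) =
      p * W.formalParameter Q + (W.formalParameter (p • Q) - p * W.formalParameter Q) := by ring
  rw [e]
  refine (IsUltrametricDist.norm_add_le_max _ _).trans (max_le ?_ ?_)
  · rw [norm_mul, Padic.norm_p, pow_two]
    exact mul_le_mul_of_nonneg_left hQ1 hθ0
  · refine (norm_formalParameter_prime_nsmul_sub_le_max W hQ).trans (max_le ?_ ?_)
    · rw [Padic.norm_p]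
      calc (p : ℝ)⁻¹ * r ^ 2 ≤ (p : ℝ)⁻¹ * r := by
            refine mul_le_mul_of_nonneg_left ?_ hθ0
            calc r ^ 2 = r * r := pow_two r
              _ ≤ 1 * r := mul_le_mul_of_nonneg_right hr1 hr0
              _ = r := one_mul r
        _ ≤ (p : ℝ)⁻¹ * (p : ℝ)⁻¹ := mul_le_mul_of_nonneg_left hQ1 hθ0
        _ = ((p : ℝ)⁻¹) ^ 2 := (pow_two _).symm
    · calc r ^ p ≤ r ^ 2 := pow_le_pow_of_le_one hr0 hr1 hp.two_le
        _ ≤ ((p : ℝ)⁻¹) ^ 2 := pow_le_pow_left₀ hr0 hQ1 2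

/-- **`p · E⁽¹⁾(ℚ_p) = E⁽²⁾(ℚ_p)` for odd `p`** as an identity of subgroups of `E(ℚ_p)`
(`WeierstrassCurve.formalFiltration`): Silverman IV.6.4(b) (`Ê(𝓜) ≅ 𝓜` additively for
`1 > v(p)/(p-1)`, whence `p Ê(𝓜) = Ê(𝓜²)`) transported to `E₁(ℚ_p)` by VII.2.2 — §2 gives `⊇`,
`norm_formalParameter_prime_nsmul_le_inv_sq` gives `⊆`. [cite: SilvermanAEC2009, Thm. IV.6.4]
[cite: SilvermanAEC2009, Prop. VII.2.2] -/
theorem map_nsmul_formalFiltration_one_eq_two (hp2 : p ≠ 2) :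
    (W.formalFiltration 1).map (nsmulAddMonoidHom p) = W.formalFiltration 2 := by
  ext T
  rw [AddSubgroup.mem_map]
  constructor
  · rintro ⟨Q, hQ, rfl⟩
    rw [WeierstrassCurve.mem_formalFiltration_iff, pow_one] at hQ
    exact ⟨W.isInReductionKernel_nsmul hQ.1 p, norm_formalParameter_prime_nsmul_le_inv_sq W hQ.1 hQ.2⟩
  · intro hT
    obtain ⟨Q, hQK, hQz, hQT⟩ :=
      exists_nsmul_eq_of_norm_formalParameter_le_inv_sq W hp2 hT.1 hT.2
    exact ⟨Q, ⟨hQK, by rwa [pow_one]⟩, hQT⟩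

/-! ### §3. The rational-point reading over `ℚ_p` -/

/-- **Division of an affine point of `E(ℚ_p)` deep in the kernel of reduction, odd `p`**: for a
`p`-integral elliptic `W/ℚ_p`, `p ≠ 2`, and `P = (x, y) ∈ E(ℚ_p)` with `‖x‖ > 1` (i.e.
`P ∈ E₁(ℚ_p)`) and `‖x / y‖ ≤ p⁻²` (i.e. `v_p(x/y) ≥ 2`), there is `Q ∈ E(ℚ_p)` with `p • Q = P`.
[cite: SilvermanAEC2009, Thm. IV.6.4] [cite: SilvermanAEC2009, Prop. VII.2.2] -/
theorem exists_nsmul_eq_of_one_lt_norm_of_norm_le (hp2 : p ≠ 2) {x y : ℚ_[p]}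
    (h : W.toAffine.Nonsingular x y) (hx : 1 < ‖x‖) (hz : ‖x / y‖ ≤ ((p : ℝ)⁻¹) ^ 2) :
    ∃ Q : W.toAffine.Point, p • Q = .some x y h := by
  have hT : W.IsInReductionKernel (.some x y h) := (W.isInReductionKernel_some h).mpr hx
  have hTz : ‖W.formalParameter (.some x y h)‖ ≤ ((p : ℝ)⁻¹) ^ 2 := by
    rw [W.formalParameter_some h, neg_div, norm_neg]; exact hz
  obtain ⟨Q, -, -, hQ⟩ := exists_nsmul_eq_of_norm_formalParameter_le_inv_sq W hp2 hT hTz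
  exact ⟨Q, hQ⟩

end Summit.BirchSwinnertonDyer.Rank1Residual.GaloisImage.LocalDivisibility

end
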